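import Summits.BirchSwinnertonDyer.BirchSwinnertonDyer.Theorems.AdditiveKolyvaginRoadKolyvaginPrimitiveAdditiveRankLowering
import Summits.BirchSwinnertonDyer.BirchSwinnertonDyer.Theorems.AdditiveKolyvaginRoadTwoPlaceLagrangian
import Summits.BirchSwinnertonDyer.BirchSwinnertonDyer.Theorems.AdditiveKolyvaginRoadLocalDictionaries
import Summits.BirchSwinnertonDyer.BirchSwinnertonDyer.Theorems.AdditiveKolyvaginRoadLevelJumpAboveP
import Summits.BirchSwinnertonDyer.BirchSwinnertonDyer.Theorems.AdditiveKolyvaginRoadAdmissibleRaiseFree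
import Literature.NumberTheory.EllipticCurves.BSDConductorProofs
import Literature.NumberTheory.Automorphic.GaloisActionPlaces
import HarnessLib

/-!
# Route `AdditiveKolyvaginRoad`, crux `LevelKolyvaginSystemsAdditive` (item stmt-BirchSwinnertonDyer-21396, KS′) ∕ KPA′ (21400):
# BRICKS FOR S-vis (a 𝔭-visible even core vertex; support lemma `VisibleEvenCoreLevel` of the crux-ideate card
# `Cruxes/LevelKolyvaginSystemsAdditive/Ideas/pointwise-klingen-seed.md`) — Kummer × non-Kummer at an admissible place, four folklore
# helpers, the DESCENT TO A ZERO VERTEX by iterated rank lowering, and the EIGEN-PARTNER at a level above `p`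
# (cell `pub/bsd-wall`, width seat `bsd-wall-akr-p2x-w2` g9; `--supports stmt-BirchSwinnertonDyer-21396`, helper; part 1 of 2, sequel
# `…VisibleEvenCoreLevel.lean`)

WHAT (namespace `…Theorems.AdditiveKoly`; level written `p ^ 1` as in the carrier `Vp W K p`).
* §1 `cupProduct_ne_zero_of_kummer_of_not_kummer_admQ` — at the place `v` of a Bertolini–Darmon admissible prime, for `K` imaginary quadratic:
  `r` Kummer at `v` with `loc_v r ≠ 0` and `y` NOT Kummer at `v` ⟹ `loc_v r ∪ₑ loc_v y ≠ 0` (the Kummer condition `F_v` has `p` elements —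
  `natCard_kummer_eq_of_admQ` — so `loc_v r` generates it, and `F_v` is its own annihilator — `annRight_kummer_eq_P` for a perfect family,
  which exists by the PROVED `poitouTate_sum_localTatePairing_eq_zero_of_isTotallyComplex`). UNCONDITIONAL. The admissible-prime twin of
  w3 g9's `cupProduct_ne_zero_of_selmer_of_not_selmer_P` (Kolyvagin primes), with NO sign condition.
* §2 folklore: `eq_zero_of_two_zsmul_of_odd_zsmul` (`2` is invertible on odd torsion), `algEquiv_eq_one_or_eq_of_finrank_two`
  (`Aut(K/ℚ) = {1, c}`), `under_eq_under_of_natCast_mem` (two places above `p` lie over the same place of `ℚ`),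
  `exists_heightOneSpectrum_natCast_mem'` (a place above `p` exists).
* §3 `localCheb_of_admQ_of_dvd` ((Cheb) with `p ∣ N_E` in place of `Addv W p`), `selQP_rankLowering_of_dvd` ((A1) W. Zhang Prop. 5.4 +
  Lemma 7.3 = the conclusion of the route's `stub_rankLoweringAdditive` from exactly the hypotheses it uses: `p ≥ 5`, `p ∣ N_E`, `ρ̄` onto,
  `K` imaginary quadratic + Heegner, `c ≠ 1`), and `exists_zero_vertex_above` — DESCENT TO A ZERO VERTEX: above every level `n` there is
  `n' ⊇ n` with `Sel_{n'}^± = 0` and `#n' = #n + dim Sel_n⁺ + dim Sel_n⁻` (one admissible prime per dimension). UNCONDITIONAL.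
* §4 `exists_eigen_levelPartner_above_p` — the EIGEN-PARTNER at level `m` above `p`: granted `poitouTate_selmerStructure_duality K`, for a
  place `w₀ ∣ p` an EIGENclass of complex conjugation (some sign), Kummer at `∞` and at the finite places NOT above `p` and above no prime of
  `m`, toric above the primes of `m`, NOT locally trivial at `w₀` — my `exists_levelRelaxed_notMem_torsionLocalKer_above_p` (the level-`m`
  jump above `p`, `…LevelJumpAboveP.lean`) + eigen-splitting `t ± c_* t` (`2` invertible on `p`-torsion; `c`-stability of the relaxed
  conditions: `conjAct_mem_relaxedAt`).

HONEST FRAMING: theorems only; 0 definitions, 0 named facts, 0 `sorry`; closes nothing. BSD is not proved by any of this; KS′ ∕ KPA′ stay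
OPEN at `p² ∣ N`.

References: [cite: WZhang2014, Prop. 5.4, Lemma 5.3, Lemma 7.3, §9 (9.1)–(9.2)] [cite: BertoliniDarmon2005, Lemma 2.6, Thm. 3.2]
[cite: MilneADT2006, Ch. I, Cor. 2.3, Thm. 4.10] [cite: MazurRubin2004, Prop. 4.5.8, Lemma 4.1.7] [cite: Howard2006Bipartite, Cor. 2.3.5]
[cite: CasselsFrohlichANT1967, Ch. VII Prop. 1.2 (ii)].
-/

set_option linter.dupNamespace false -- single-conjunct summit repeats the name by design

noncomputable section

open scoped Classical NumberField Pointwise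

namespace Summit.BirchSwinnertonDyer.BirchSwinnertonDyer.Theorems.AdditiveKoly

open CategoryTheory WeierstrassCurve Field Function NumberField IsDedekindDomain
open Literature.NumberTheory.EllipticCurves Literature.NumberTheory.EllipticCurves.ModularForms
  Literature.NumberTheory.GaloisRepresentations Literature.NumberTheory.GaloisRepresentations.DiscreteGaloisModule
  Literature.NumberTheory.GaloisCohomology Module
open Summit.BirchSwinnertonDyer.Rank1Residual.X11b.FiniteDuality
open Summit.BirchSwinnertonDyer.Rank1Residual.X11b.Relaxation
open Summit.BirchSwinnertonDyer.Rank1Residual.X11b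
open Summit.BirchSwinnertonDyer.Rank1Residual.GaloisImage
open Summit.BirchSwinnertonDyer.Rank1Residual.X11b.Three.Koly
open Summit.BirchSwinnertonDyer.Rank1Residual.X11b.Three.Koly.Method2
open Summit.BirchSwinnertonDyer.Rank1Residual.X11b.Three.Koly.ZhangSupply.LocalConj
open scoped ContRepresentation

/-! ## §1 Local non-vanishing at an admissible place: Kummer × non-Kummer -/

section LocalNonvanishing

variable (W : WeierstrassCurve ℚ) (K : Type) [Field K] [NumberField K] (p : ℕ) [W.IsElliptic] [W.IsGloballyMinimal]
  [Fact p.Prime] [IsTotallyComplex K] [∀ v : Place K, CompactSpace (absoluteGaloisGroup (Place.Completion v))]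
variable (e : geomTorsion (W.baseChange K) ((p ^ 1 : ℕ) : ℤ) → geomTorsion (W.baseChange K) ((p ^ 1 : ℕ) : ℤ) →
    AlgebraicClosure K)
  (hμ : ∀ S T, e S T ^ (p ^ 1) = 1)
  (hadd₁ : ∀ S₁ S₂ T, e (S₁ + S₂) T = e S₁ T * e S₂ T)
  (hadd₂ : ∀ S T₁ T₂, e S (T₁ + T₂) = e S T₁ * e S T₂) (halt : ∀ Q, e Q Q = 1)
  (hnondeg : ∀ Q, (∀ P, e P Q = 1) → Q = 0)
  (hgal : ∀ (σ : absoluteGaloisGroup K) (S T : geomTorsion (W.baseChange K) ((p ^ 1 : ℕ) : ℤ)),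
    σ • e S T = e (σ • S) (σ • T))

include halt hnondeg in
/-- **Kummer × non-Kummer does not vanish at an admissible place.** `K` imaginary quadratic, `q` Bertolini–Darmon admissible with
place `v`: if `r ∈ H¹(K, E[p])` satisfies E's Kummer condition at `v` with `loc_v r ≠ 0` and `y` does NOT satisfy the Kummer condition
at `v`, then the local Weil cup product `loc_v r ∪ₑ loc_v y` is non-zero. Proof: the Kummer condition `F_v ≤ H¹(K_v, E[p])` has `p`
elements (`natCard_kummer_eq_of_admQ`), so it is generated by `loc_v r`; it is its own annihilator for `inv_v(· ∪ₑ ·)`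
(`annRight_kummer_eq_P`, a perfect Poitou–Tate family existing by the PROVED `poitouTate_sum_localTatePairing_eq_zero_of_isTotallyComplex`);
so `loc_v r ∪ₑ loc_v y = 0` would put `loc_v y` in `F_v`. [cite: BertoliniDarmon2005, Lemma 2.6] [cite: MilneADT2006, Ch. I, Cor. 2.3] -/
theorem cupProduct_ne_zero_of_kummer_of_not_kummer_admQ (hK : IsImaginaryQuadratic K) (q : AdmQ W K p)
    (v : HeightOneSpectrum (𝓞 K)) (hqv : ((q : ℕ) : 𝓞 K) ∈ v.asIdeal) {r y : Vp W K p}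
    (hr : r ∈ selmerLocalKer (W.baseChange K) (v.adicCompletion K) ((p ^ 1 : ℕ) : ℤ))
    (hr0 : r ∉ (W.baseChange K).torsionLocalKer (v.adicCompletion K) ((p ^ 1 : ℕ) : ℤ))
    (hy : y ∉ selmerLocalKer (W.baseChange K) (v.adicCompletion K) ((p ^ 1 : ℕ) : ℤ)) :
    (weilContPairingLocal (W.baseChange K) (p ^ 1) e hμ hadd₁ hadd₂ hgal (Sum.inr v)).cupProduct
        (galoisCohomology.localization ((W.baseChange K).torsionGaloisModule ((p ^ 1 : ℕ) : ℤ)) (Sum.inr v) 1 r)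
        (galoisCohomology.localization ((W.baseChange K).torsionGaloisModule ((p ^ 1 : ℕ) : ℤ)) (Sum.inr v) 1 y) ≠ 0 := by
  have hp : p.Prime := Fact.out
  haveI : NeZero (p ^ 1 : ℕ) := ⟨pow_ne_zero 1 hp.ne_zero⟩
  haveI : Fact (Nat.Prime (p ^ 1)) := ⟨by rw [pow_one]; exact hp⟩
  obtain ⟨inv, hperf, -⟩ := poitouTate_sum_localTatePairing_eq_zero_of_isTotallyComplex K (p ^ 1)
  set loc := galoisCohomology.localization ((W.baseChange K).torsionGaloisModule ((p ^ 1 : ℕ) : ℤ)) (Sum.inr v) 1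
    with hloc
  set F := (W.baseChange K).kummerSelmerStructure ((p ^ 1 : ℕ) : ℤ) (Sum.inr v) with hF
  set b := invWeilPairing (W.baseChange K) (p ^ 1) e hμ hadd₁ hadd₂ hgal inv (Sum.inr v) with hb
  -- `loc r ∈ F`, `loc r ≠ 0`, `loc y ∉ F`
  have hrF : loc r ∈ F := by
    rw [hF, WeierstrassCurve.kummerSelmerStructure_apply]
    exact (mem_selmerLocalKer_iff_localization_mem_kummer_P W K p v r).mp hr
  have hr0' : loc r ≠ 0 := fun h ↦ hr0 ((mem_torsionLocalKer_iff_localization_eq_zero_P W K p v r).mpr h)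
  have hyF : loc y ∉ F := fun h ↦ hy ((mem_selmerLocalKer_iff_localization_mem_kummer_P W K p v y).mpr (by
    rw [hF, WeierstrassCurve.kummerSelmerStructure_apply] at h
    exact h))
  -- `F` has `p` elements, hence is generated by `loc r`
  have hcard : Nat.card F = p := natCard_kummer_eq_of_admQ W K p hK q v hqv
  have hgen : ∀ l ∈ F, ∃ k : ℤ, k • loc r = l := by
    intro l hl
    have hne : (⟨loc r, hrF⟩ : F) ≠ 0 := fun h ↦ hr0' (by
      have := congrArg Subtype.val h
      exact this)
    have htop := zmultiples_eq_top_of_prime_card (p := p) hcard hne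
    have hmem : (⟨l, hl⟩ : F) ∈ AddSubgroup.zmultiples (⟨loc r, hrF⟩ : F) := by
      rw [htop]; exact AddSubgroup.mem_top _
    obtain ⟨k, hk⟩ := AddSubgroup.mem_zmultiples_iff.mp hmem
    exact ⟨k, by
      have := congrArg Subtype.val hk
      simpa only [AddSubgroupClass.coe_zsmul] using this⟩
  -- the annihilator of `F` is `F`
  have hann := annRight_kummer_eq_P W K p e hμ hadd₁ hadd₂ halt hnondeg hgal inv hK hperf (Sum.inr v)
  intro h0
  have hb0 : b (loc r) (loc y) = 0 := by
    rw [hb, invWeilPairing_apply, h0]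
    exact map_zero _
  have hyann : loc y ∈ annRight b F := by
    rw [mem_annRight_iff]
    intro l hl
    obtain ⟨k, rfl⟩ := hgen l hl
    rw [map_zsmul, AddMonoidHom.zsmul_apply, hb0, smul_zero]
  rw [hb, hF, hann] at hyann
  exact hyF (by rw [hF]; exact hyann)

end LocalNonvanishing

/-! ## §2 Four small folklore helpers -/

section Helpers

/-- Odd torsion kills `2`-torsion: `2 • a = 0` and `N • a = 0` with `N` odd force `a = 0`. [folklore] -/
theorem eq_zero_of_two_zsmul_of_odd_zsmul {A : Type*} [AddCommGroup A] {a : A} {N : ℤ} (hN : Odd N)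
    (h2 : (2 : ℤ) • a = 0) (hNa : N • a = 0) : a = 0 := by
  obtain ⟨k, rfl⟩ := hN
  have h : (2 * k + 1) • a = k • ((2 : ℤ) • a) + a := by
    rw [smul_smul, add_zsmul, one_zsmul, mul_comm k 2]
  rw [hNa, h2, smul_zero, zero_add] at h
  exact h.symm

/-- In a quadratic field with a non-trivial automorphism `c`, every automorphism is `1` or `c`
(`#Aut(K/ℚ) ≤ [K : ℚ] = 2`). [folklore] -/
theorem algEquiv_eq_one_or_eq_of_finrank_two {K : Type} [Field K] [NumberField K]
    (h2 : Module.finrank ℚ K = 2) {c : K ≃ₐ[ℚ] K} (hc : c ≠ 1) (σ : K ≃ₐ[ℚ] K) : σ = 1 ∨ σ = c := by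
  classical
  by_contra h
  obtain ⟨h₁, h₂⟩ := not_or.mp h
  have h3 : ({1, c, σ} : Finset (K ≃ₐ[ℚ] K)).card = 3 := by
    rw [Finset.card_insert_of_notMem, Finset.card_insert_of_notMem, Finset.card_singleton]
    · simpa using fun h' => h₂ h'.symm
    · simp only [Finset.mem_insert, Finset.mem_singleton, not_or]
      exact ⟨fun h' => hc h'.symm, fun h' => h₁ h'.symm⟩
  have h4 := Finset.card_le_univ ({1, c, σ} : Finset (K ≃ₐ[ℚ] K))
  rw [h3] at h4
  have h5 : Fintype.card (K ≃ₐ[ℚ] K) ≤ 2 := h2 ▸ AlgEquiv.card_le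
  omega

/-- Two places of a number field `K` containing the rational prime `p` lie over the same place of `ℚ`. [folklore] -/
theorem under_eq_under_of_natCast_mem {K : Type} [Field K] [NumberField K] {p : ℕ} (hp : p.Prime)
    {w u : HeightOneSpectrum (𝓞 K)} (hw : ((p : ℕ) : 𝓞 K) ∈ w.asIdeal) (hu : ((p : ℕ) : 𝓞 K) ∈ u.asIdeal) :
    w.under (𝓞 ℚ) = u.under (𝓞 ℚ) := by
  have h1 := (natCast_mem_asIdeal_iff_eq_primesEquiv_symm (w.under (𝓞 ℚ)) hp).mp (by
    change ((p : ℕ) : 𝓞 ℚ) ∈ Ideal.comap (algebraMap (𝓞 ℚ) (𝓞 K)) w.asIdeal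
    rw [Ideal.mem_comap, map_natCast]; exact hw)
  have h2 := (natCast_mem_asIdeal_iff_eq_primesEquiv_symm (u.under (𝓞 ℚ)) hp).mp (by
    change ((p : ℕ) : 𝓞 ℚ) ∈ Ideal.comap (algebraMap (𝓞 ℚ) (𝓞 K)) u.asIdeal
    rw [Ideal.mem_comap, map_natCast]; exact hu)
  rw [h1, h2]

/-- Every number field has a finite place above the rational prime `p` (Mathlib
`Ideal.exists_maximal_ideal_liesOver_of_isIntegral`). [folklore] -/
theorem exists_heightOneSpectrum_natCast_mem' (F : Type*) [Field F] [NumberField F] {p : ℕ}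
    (hp : p.Prime) : ∃ w : HeightOneSpectrum (𝓞 F), ((p : ℕ) : 𝓞 F) ∈ w.asIdeal := by
  have hp0 : Ideal.span {(p : ℤ)} ≠ ⊥ := by
    rw [Ne, Ideal.span_singleton_eq_bot]; exact_mod_cast hp.ne_zero
  haveI : (Ideal.span {(p : ℤ)}).IsMaximal :=
    ((Ideal.span_singleton_prime (by exact_mod_cast hp.ne_zero)).mpr
      (Nat.prime_iff_prime_int.mp hp)).isMaximal hp0
  obtain ⟨Q, hQmax, hQover⟩ :=
    Ideal.exists_maximal_ideal_liesOver_of_isIntegral (S := 𝓞 F) (Ideal.span {(p : ℤ)})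
  have hQ0 : Q ≠ ⊥ := Ideal.ne_bot_of_liesOver_of_ne_bot hp0 Q
  refine ⟨⟨Q, hQmax.isPrime, hQ0⟩, ?_⟩
  have h : algebraMap ℤ (𝓞 F) (p : ℤ) ∈ Q := by
    rw [← Ideal.mem_comap, ← Ideal.under_def, ← hQover.over]
    exact Ideal.mem_span_singleton_self _
  rwa [map_natCast] at h

end Helpers

/-! ## §3 Descent to a ZERO vertex (iterated rank lowering A1, `p ∣ N_E` form) -/

section Descent

variable (W : WeierstrassCurve ℚ) (K : Type) [Field K] [NumberField K] (p : ℕ) [W.IsElliptic] [W.IsGloballyMinimal]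
  [Fact p.Prime]

/-- **(Cheb) from `p ∣ N_E`** (the binder shape of `selQP_rankLowering_of_localGlobal`): every non-zero class of `Sel_n^μ` is detected at
the place of some NEW Bertolini–Darmon admissible prime — `Cheb.exists_admissible_loc_ne_zero` (W. Zhang Lemma 7.3 ∕ Bertolini–Darmon
Thm. 3.2), exactly as akr-p1 g2's `localCheb_of_admQ` but with `p ∣ N_E` in place of `Addv W p`. [cite: WZhang2014, Lemma 7.3]
[cite: BertoliniDarmon2005, Thm. 3.2] -/
theorem localCheb_of_admQ_of_dvd (h5 : 5 ≤ p) (hpN : p ∣ W.conductorNorm ℤ) (hsurj : W.HasSurjectiveModNGaloisRep p)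
    (hK : IsImaginaryQuadratic K) (hH : SatisfiesHeegnerHypothesis (W.conductorNorm ℤ) K)
    {c : K ≃ₐ[ℚ] K} (hc1 : c ≠ 1) [Module (ZMod p) (Vp W K p)] :
    ∀ (n : Finset (AdmQ W K p)) (μ : Bool) (x : Vp W K p), x ∈ SelQP W K p c n μ → x ≠ 0 →
      ∃ q : AdmQ W K p, q ∉ n ∧ ∃ v : HeightOneSpectrum (𝓞 K),
        ((q : ℕ) : 𝓞 K) ∈ v.asIdeal ∧ (W.baseChange K).torsionLocMap (v.adicCompletion K) ((p ^ 1 : ℕ) : ℤ) x ≠ 0 := by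
  intro n μ x hx hx0
  have hp : p.Prime := Fact.out
  haveI : Fact (Nat.Prime (p ^ 1)) := ⟨by rw [pow_one]; exact hp⟩
  have h5' : 5 ≤ p ^ 1 := by rw [pow_one]; exact h5
  have hpN' : p ^ 1 ∣ W.conductorNorm ℤ := by rw [pow_one]; exact hpN
  have hsurj' : W.HasSurjectiveModNGaloisRep ((p ^ 1 : ℕ) : ℤ) := by rw [Nat.pow_one]; exact hsurj
  have hν : sgnP μ = 1 ∨ sgnP μ = -1 := by cases μ <;> simp [sgnP]
  have hxν : conjAct W c ((p ^ 1 : ℕ) : ℤ) x = sgnP μ • x := conjAct_eq_of_mem_selQP W K p c n μ hx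
  obtain ⟨q, hqB, hadm, v, hqv, hloc⟩ := Cheb.exists_admissible_loc_ne_zero W K (p := p ^ 1) h5' hK hsurj' hpN' hH
    hc1 hν hx0 hxν (n.image Subtype.val)
  rw [Nat.pow_one] at hadm
  refine ⟨⟨q, hadm⟩, fun hqn ↦ hqB (Finset.mem_image.mpr ⟨⟨q, hadm⟩, hqn, rfl⟩), v, hqv, fun h0 ↦ hloc h0⟩

/-- **(A1) RANK LOWERING at a frame with `p ∣ N_E`** — W. Zhang Prop. 5.4 + Lemma 7.3 for the canonical spaces, the conclusion of the
route's `stub_rankLoweringAdditive` with only the hypotheses it uses: akr-p1's `selQP_rankLowering_of_localGlobal` fed with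
`localCheb_of_admQ_of_dvd`, `localEquiv_of_admQ`, `localLine_of_admQ`, `localTrans_of_admQ`, `hiso_of_admQ` (all kernel theorems).
[cite: WZhang2014, Prop. 5.4, Lemma 7.3, §9 (9.1)–(9.2)] [cite: BertoliniDarmon2005, Lemma 2.6, Thm. 3.2] -/
theorem selQP_rankLowering_of_dvd (h5 : 5 ≤ p) (hpN : p ∣ W.conductorNorm ℤ) (hsurj : W.HasSurjectiveModNGaloisRep p)
    (hK : IsImaginaryQuadratic K) (hH : SatisfiesHeegnerHypothesis (W.conductorNorm ℤ) K)
    {c : K ≃ₐ[ℚ] K} (hc1 : c ≠ 1) [Module (ZMod p) (Vp W K p)] :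
    ∀ (n : Finset (AdmQ W K p)) (μ : Bool) (x : Vp W K p),
      x ∈ SelQP W K p c n μ → x ≠ 0 →
      ∃ q : AdmQ W K p, q ∉ n ∧ x ∉ SelQP W K p c (insert q n) μ ∧
        SelQP W K p c (insert q n) μ ≤ SelQP W K p c n μ ∧
        finrank (ZMod p) (SelQP W K p c (insert q n) μ) + 1 = finrank (ZMod p) (SelQP W K p c n μ) ∧
        SelQP W K p c (insert q n) (!μ) = SelQP W K p c n (!μ) :=
  selQP_rankLowering_of_localGlobal W K p c ((Fact.out : p.Prime).odd_of_ne_two (by omega))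
    (localCheb_of_admQ_of_dvd W K p h5 hpN hsurj hK hH hc1) (localEquiv_of_admQ W K p hK.1 hc1)
    (localLine_of_admQ W K p hK.1) (localTrans_of_admQ W K p) (hiso_of_admQ W K p c hK)

/-- **DESCENT TO A ZERO VERTEX.** At such a frame, above every level `n` there is a level `n' ⊇ n` with `Sel_{n'}^± = 0` and
`#n' = #n + dim Sel_n⁺ + dim Sel_n⁻` (one new admissible prime per dimension, by (A1)). [cite: WZhang2014, Prop. 5.4, Lemma 7.3]
[cite: Howard2006Bipartite, Cor. 2.3.5] -/
theorem exists_zero_vertex_above (h5 : 5 ≤ p) (hpN : p ∣ W.conductorNorm ℤ) (hsurj : W.HasSurjectiveModNGaloisRep p)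
    (hK : IsImaginaryQuadratic K) (hH : SatisfiesHeegnerHypothesis (W.conductorNorm ℤ) K)
    {c : K ≃ₐ[ℚ] K} (hc1 : c ≠ 1) [Module (ZMod p) (Vp W K p)] (n : Finset (AdmQ W K p)) :
    ∃ n' : Finset (AdmQ W K p), n ⊆ n' ∧ (∀ μ : Bool, SelQP W K p c n' μ = ⊥) ∧
      n'.card = n.card + (finrank (ZMod p) (SelQP W K p c n true) + finrank (ZMod p) (SelQP W K p c n false)) := by
  -- induction on the total dimension
  suffices h : ∀ (r : ℕ) (n : Finset (AdmQ W K p)),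
      finrank (ZMod p) (SelQP W K p c n true) + finrank (ZMod p) (SelQP W K p c n false) = r →
      ∃ n' : Finset (AdmQ W K p), n ⊆ n' ∧ (∀ μ : Bool, SelQP W K p c n' μ = ⊥) ∧ n'.card = n.card + r from
    h _ n rfl
  intro r
  induction r with
  | zero =>
    intro n hn
    refine ⟨n, subset_rfl, fun μ ↦ ?_, by rw [add_zero]⟩
    haveI := finiteDimensional_selQP W K p c n μ
    have h0 : finrank (ZMod p) (SelQP W K p c n μ) = 0 := by cases μ <;> omega
    exact Submodule.finrank_eq_zero.mp h0
  | succ r ih =>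
    intro n hn
    -- some sign has a non-zero class
    obtain ⟨μ, hμ⟩ : ∃ μ : Bool, 0 < finrank (ZMod p) (SelQP W K p c n μ) := by
      by_cases h : 0 < finrank (ZMod p) (SelQP W K p c n true)
      · exact ⟨true, h⟩
      · exact ⟨false, by omega⟩
    haveI := finiteDimensional_selQP W K p c n μ
    obtain ⟨x, hx, hx0⟩ : ∃ x ∈ SelQP W K p c n μ, x ≠ 0 := by
      by_contra hall
      push Not at hall
      have : SelQP W K p c n μ = ⊥ := (Submodule.eq_bot_iff _).mpr hall
      rw [this, finrank_bot] at hμ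
      exact lt_irrefl 0 hμ
    obtain ⟨q, hqn, -, -, hfr, heq⟩ := selQP_rankLowering_of_dvd W K p h5 hpN hsurj hK hH hc1 n μ x hx hx0
    -- the total dimension at `insert q n` is `r`
    have htot : finrank (ZMod p) (SelQP W K p c (insert q n) true) +
        finrank (ZMod p) (SelQP W K p c (insert q n) false) = r := by
      cases μ
      · have heq' : SelQP W K p c (insert q n) true = SelQP W K p c n true := heq
        rw [heq']
        omega
      · have heq' : SelQP W K p c (insert q n) false = SelQP W K p c n false := heq
        rw [heq']
        omega
    obtain ⟨n', hsub, hzero, hcard⟩ := ih (insert q n) htot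
    refine ⟨n', (Finset.subset_insert q n).trans hsub, hzero, ?_⟩
    rw [hcard, Finset.card_insert_of_notMem hqn]
    omega

end Descent

/-! ## §4 The eigen-partner of the level-`m` structure above `p` -/

section Partner

variable (W : WeierstrassCurve ℚ) (K : Type) [Field K] [NumberField K] (p : ℕ) [W.IsElliptic] [W.IsGloballyMinimal]
  [Fact p.Prime]

/-- **THE EIGEN-PARTNER ABOVE `p` AT LEVEL `m`.** `K` imaginary quadratic, `p` odd, `c ∈ Aut(K/ℚ)`, the Poitou–Tate fact for `K`, `m` a finite
set of admissible primes, `w₀ ∣ p`: there is an eigenclass `t` of `c_*` (sign `s`) satisfying E's Kummer condition at the infinite places and at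
every finite place NOT above `p` and above no prime of `m`, the toric condition above the primes of `m`, and NOT locally trivial at `w₀`. Proof:
the level-`m` jump at the relaxed place `w₀` (`exists_levelRelaxed_notMem_torsionLocalKer_above_p`) gives `t₀`; the relaxed conditions are
`c`-stable (`conjAct_mem_relaxedAt` with the relaxed prime `p`), so `t₀ ± c_* t₀` are eigenclasses satisfying them, and one of the two is still
detected at `w₀` because their sum `2 t₀` is (`2` is invertible on the `p`-torsion group `H¹(K_{w₀}, E[p])`).
[cite: WZhang2014, Lemma 5.3] [cite: GrossLMS1991, §5 (5.1)] [cite: MilneADT2006, Ch. I, Thm. 4.10] -/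
theorem exists_eigen_levelPartner_above_p (hK : IsImaginaryQuadratic K) (hp2 : p ≠ 2) (c : K ≃ₐ[ℚ] K)
    (hPT : poitouTate_selmerStructure_duality K) (m : Finset (AdmQ W K p))
    (w₀ : HeightOneSpectrum (𝓞 K)) (hw₀ : ((p : ℕ) : 𝓞 K) ∈ w₀.asIdeal) :
    ∃ (s : Bool) (t : Vp W K p), conjAct W c ((p ^ 1 : ℕ) : ℤ) t = sgnP s • t ∧
      (∀ u : InfinitePlace K, t ∈ selmerLocalKer (W.baseChange K) u.Completion ((p ^ 1 : ℕ) : ℤ)) ∧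
      (∀ v' : HeightOneSpectrum (𝓞 K), ((p : ℕ) : 𝓞 K) ∉ v'.asIdeal →
        ((∀ q' ∈ m, ((q' : ℕ) : 𝓞 K) ∉ v'.asIdeal) →
          t ∈ selmerLocalKer (W.baseChange K) (v'.adicCompletion K) ((p ^ 1 : ℕ) : ℤ)) ∧
        (∀ q' ∈ m, ((q' : ℕ) : 𝓞 K) ∈ v'.asIdeal →
          t ∈ toricLocalKer (W.baseChange K) (v'.adicCompletion K) ((p ^ 1 : ℕ) : ℤ))) ∧
      t ∉ (W.baseChange K).torsionLocalKer (w₀.adicCompletion K) ((p ^ 1 : ℕ) : ℤ) := by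
  have hp : p.Prime := Fact.out
  have hNodd : Odd (((p ^ 1 : ℕ) : ℤ)) := by
    rw [pow_one]
    exact_mod_cast hp.odd_of_ne_two hp2
  have hcc : c * c = 1 := algEquiv_mul_self_eq_one K hK c
  set τ := conjAct W c ((p ^ 1 : ℕ) : ℤ) with hτ
  have hττ : ∀ y : Vp W K p, τ (τ y) = y := fun y ↦ conjAct_conjAct_of_mul_self W hcc ((p ^ 1 : ℕ) : ℤ) y
  haveI : ∀ w : Place K, CompactSpace (absoluteGaloisGroup (Place.Completion w)) := fun w ↦
    absoluteGaloisGroup_compactSpace _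
  obtain ⟨t, htinf, htfin, htw₀⟩ := exists_levelRelaxed_notMem_torsionLocalKer_above_p W K p hK hPT m w₀ hw₀
  -- the level-`m` conditions relaxed at ALL places above `p`
  set REL : Vp W K p → Prop := fun x ↦
    (∀ u : InfinitePlace K, x ∈ selmerLocalKer (W.baseChange K) u.Completion ((p ^ 1 : ℕ) : ℤ)) ∧
      (∀ v' : HeightOneSpectrum (𝓞 K), ((p : ℕ) : 𝓞 K) ∉ v'.asIdeal →
        ((∀ q' ∈ m, ((q' : ℕ) : 𝓞 K) ∉ v'.asIdeal) →
          x ∈ selmerLocalKer (W.baseChange K) (v'.adicCompletion K) ((p ^ 1 : ℕ) : ℤ)) ∧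
        (∀ q' ∈ m, ((q' : ℕ) : 𝓞 K) ∈ v'.asIdeal →
          x ∈ toricLocalKer (W.baseChange K) (v'.adicCompletion K) ((p ^ 1 : ℕ) : ℤ))) with hREL
  have hREL_t : REL t := ⟨htinf, fun v' hv' ↦ htfin v' (fun h ↦ hv' (h ▸ hw₀))⟩
  have hREL_add : ∀ x y, REL x → REL y → REL (x + y) := fun x y hx hy ↦
    ⟨fun u ↦ add_mem (hx.1 u) (hy.1 u), fun v' hv' ↦
      ⟨fun h ↦ add_mem ((hx.2 v' hv').1 h) ((hy.2 v' hv').1 h),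
        fun q' hq' hq'v' ↦ add_mem ((hx.2 v' hv').2 q' hq' hq'v') ((hy.2 v' hv').2 q' hq' hq'v')⟩⟩
  have hREL_sub : ∀ x y, REL x → REL y → REL (x - y) := fun x y hx hy ↦
    ⟨fun u ↦ sub_mem (hx.1 u) (hy.1 u), fun v' hv' ↦
      ⟨fun h ↦ sub_mem ((hx.2 v' hv').1 h) ((hy.2 v' hv').1 h),
        fun q' hq' hq'v' ↦ sub_mem ((hx.2 v' hv').2 q' hq' hq'v') ((hy.2 v' hv').2 q' hq' hq'v')⟩⟩
  have hREL_τ : ∀ x, REL x → REL (τ x) := fun x hx ↦ conjAct_mem_relaxedAt W K p hK c m p x hx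
  -- eigen-splitting `t ± τ t` — one of the two is still detected at `w₀`
  by_cases hplus : t + τ t ∈ (W.baseChange K).torsionLocalKer (w₀.adicCompletion K) ((p ^ 1 : ℕ) : ℤ)
  · have hR := hREL_sub _ _ hREL_t (hREL_τ _ hREL_t)
    refine ⟨false, t - τ t, ?_, hR.1, hR.2, fun hminus ↦ htw₀ ?_⟩
    · rw [map_sub, hττ, show sgnP false = -1 from rfl, neg_one_zsmul, neg_sub]
    · -- `(t + τ t) + (t - τ t) = 2 • t ∈ ker`, and `2` is invertible on the `p`-torsion local group
      have h2 : (2 : ℤ) • t ∈ (W.baseChange K).torsionLocalKer (w₀.adicCompletion K) ((p ^ 1 : ℕ) : ℤ) := by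
        have : (t + τ t) + (t - τ t) = (2 : ℤ) • t := by rw [two_zsmul]; abel
        rw [← this]
        exact add_mem hplus hminus
      change (W.baseChange K).torsionLocMap (w₀.adicCompletion K) ((p ^ 1 : ℕ) : ℤ) ((2 : ℤ) • t) = 0 at h2
      change (W.baseChange K).torsionLocMap (w₀.adicCompletion K) ((p ^ 1 : ℕ) : ℤ) t = 0
      rw [map_zsmul] at h2
      exact eq_zero_of_two_zsmul_of_odd_zsmul hNodd h2 (zsmul_discreteH1_torsion ((p ^ 1 : ℕ) : ℤ) _)
  · have hR := hREL_add _ _ hREL_t (hREL_τ _ hREL_t)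
    refine ⟨true, t + τ t, ?_, hR.1, hR.2, hplus⟩
    rw [map_add, hττ, add_comm, show sgnP true = 1 from rfl, one_zsmul]

end Partner

end Summit.BirchSwinnertonDyer.BirchSwinnertonDyer.Theorems.AdditiveKoly

end
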